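import Mathlib
import Literature.NumberTheory.Automorphic.SelbergTransformStrip
import Literature.Analysis.OperatorTheory.CompactSelfAdjointResolvent

/-!
# Resolvent kernels and meromorphy helpers for the continuation of the Eisenstein series
(Iwaniec, *Spectral Methods of Automorphic Forms*, GSM 53, §1.8 & Thm 1.16 (the Selberg /
Harish-Chandra transform `ĥ_k`), §6.2; PDF pp. 20–24, 84–85)

Support file for the general-`Γ` Chapter 6 (meromorphic continuation of `E_𝔞(z, s)` through the
resolvent of the compact self-adjoint operators `T^Y_k`, files `FuchsianEisensteinResolvent`,
`FuchsianEisensteinContinuation`). Everything is PROVED; no fact is introduced.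

1. (§0) Meromorphy is preserved by continuous linear maps and by `⟪v, ·⟫`; determinants, adjugates
   and inverses `A(z)⁻¹ c(z)` of matrices with meromorphic (analytic) entries are meromorphic
   (analytic) — Cramer's rule for the scattering row.
2. (§1) `RKernel`: a non-negative Lipschitz test kernel `k` of positive mass supported in `u ≤ M`
   with `R_M = 2 arsinh √M ≤ 1`; its STRIP `S_k = {R_M |Im s| < π/2}` is open and convex, and on it
   `ĥ_k(s) ≠ 0` and, off the lines `Im s = 0`, `Re s = 1/2`, `Im ĥ_k(s) ≠ 0` (`SelbergTransformStrip`);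
   `RKernel.ofStrip N` (the bump kernel of support `stripSupport N`) has `{|Im s| < N + 1} ⊆ S_k`.
   The base point `baseParam = s₀ = 2 + i/2` lies in every strip, `Re s₀ > 1`, `Im ĥ_k(s₀) ≠ 0`.
3. (§2) Identity principles for functions MEROMORPHIC IN NORMAL FORM (`MeromorphicNFOn`): two such
   functions on a preconnected set agreeing near a point agree everywhere
   (`MeromorphicNFOn.eqOn_of_eventuallyEq`); one agreeing near a point with an analytic function
   agrees with it, and is analytic, on any preconnected part of the domain of analyticity
   (`MeromorphicNFOn.eqOn_and_analyticOnNhd`); the normal form `toMeromorphicNFOn f U` keeps the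
   analytic germs of `f` (`toMeromorphicNFOn_eventuallyEq_of_eventuallyEq`).

## References
* [Iwaniec2002] H. Iwaniec, *Spectral Methods of Automorphic Forms*, 2nd ed., GSM 53, AMS 2002,
  §1.8, Thm 1.16, (1.62), PDF pp. 20–24; §6.2, PDF pp. 84–85
  (held copy `book:iwaniec2002-spectral-methods-automorphic-forms`).

Mathlib: `MeromorphicAt`, `MeromorphicOn`, `MeromorphicNFAt.eventuallyEq_nhdsNE_iff_eventuallyEq_nhds`,
`MeromorphicOn.toMeromorphicNFOn_eq_self_on_nhdsNE`, `meromorphicNFOn_toMeromorphicNFOn`,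
`Matrix.det_apply'`, `Matrix.adjugate_apply`, `Matrix.inv_def`, `Convex.isPreconnected`,
`Real.arsinh`. Literature: `eigenvalueFn`, `eigenvalueFn_ne_zero`, `eigenvalueFn_im_ne_zero`,
`analyticAt_eigenvalueFn`, `bumpKernel`, `stripSupport`, `kernelRadius_stripSupport_le`
(`SelbergTransformStrip`); `MeromorphicOn.eventually_eq_of_eventually_eq`, `Filter.EventuallyEq.nhdsNE_of_nhds`
(`Literature.Analysis.OperatorTheory.CompactSelfAdjointResolvent`).
-/

noncomputable section

namespace Literature.NumberTheory.Automorphic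

open _root_.MeasureTheory _root_.Set _root_.Filter _root_.Real _root_.Topology _root_.Metric _root_.UpperHalfPlane
open _root_.Literature.Analysis.OperatorTheory.CompactResolvent
open scoped _root_.ENNReal _root_.NNReal _root_.MatrixGroups _root_.Pointwise _root_.InnerProductSpace _root_.Matrix

/-! ## 0. Meromorphy helpers: continuous linear maps, inner products, determinants and inverses -/

section MeroHelpers

variable {V W : Type*} [NormedAddCommGroup V] [NormedSpace ℂ V] [NormedAddCommGroup W] [NormedSpace ℂ W]

/-- A continuous linear map applied to a meromorphic function is meromorphic. [folklore] -/
theorem _root_.ContinuousLinearMap.comp_meromorphicAt (L : V →L[ℂ] W) {f : ℂ → V} {x : ℂ}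
    (hf : MeromorphicAt f x) : MeromorphicAt (fun z => L (f z)) x := by
  obtain ⟨n, hn⟩ := hf
  refine ⟨n, ((L.analyticAt _).comp hn).congr (Eventually.of_forall fun z => ?_)⟩
  simp

/-- … on a set. [folklore] -/
theorem _root_.ContinuousLinearMap.comp_meromorphicOn (L : V →L[ℂ] W) {f : ℂ → V} {U : Set ℂ}
    (hf : MeromorphicOn f U) : MeromorphicOn (fun z => L (f z)) U := fun x hx => L.comp_meromorphicAt (hf x hx)

/-- A continuous linear map applied to an analytic function is analytic. [folklore] -/
theorem _root_.ContinuousLinearMap.comp_analyticAt' (L : V →L[ℂ] W) {f : ℂ → V} {x : ℂ}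
    (hf : AnalyticAt ℂ f x) : AnalyticAt ℂ (fun z => L (f z)) x := (L.analyticAt _).comp hf

variable {E : Type*} [NormedAddCommGroup E] [InnerProductSpace ℂ E]

/-- `z ↦ ⟪v, f z⟫` is meromorphic for meromorphic `f`. [folklore] -/
theorem MeromorphicAt.inner_const_left (v : E) {f : ℂ → E} {x : ℂ} (hf : MeromorphicAt f x) :
    MeromorphicAt (fun z => ⟪v, f z⟫_ℂ) x := by
  have h := (innerSL ℂ v).comp_meromorphicAt hf
  simpa [coe_innerSL_apply] using h

/-- `z ↦ ⟪v, f z⟫` is analytic for analytic `f`. [folklore] -/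
theorem AnalyticAt.inner_const_left (v : E) {f : ℂ → E} {x : ℂ} (hf : AnalyticAt ℂ f x) :
    AnalyticAt ℂ (fun z => ⟪v, f z⟫_ℂ) x := by
  have h := (innerSL ℂ v).comp_analyticAt' hf
  simpa [coe_innerSL_apply] using h

variable {n : Type*} [Fintype n] [DecidableEq n]

/-- **The determinant of a matrix of meromorphic functions is meromorphic.** [folklore] -/
theorem MeromorphicAt.matrix_det {A : ℂ → Matrix n n ℂ} {x : ℂ} (hA : ∀ i j, MeromorphicAt (fun z => A z i j) x) :
    MeromorphicAt (fun z => (A z).det) x := by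
  simp_rw [Matrix.det_apply']
  refine MeromorphicAt.fun_sum fun σ _ => ?_
  refine (MeromorphicAt.const _ x).mul ?_
  exact MeromorphicAt.fun_prod fun i _ => hA (σ i) i

/-- The determinant of a matrix of analytic functions is analytic. [folklore] -/
theorem AnalyticAt.matrix_det {A : ℂ → Matrix n n ℂ} {x : ℂ} (hA : ∀ i j, AnalyticAt ℂ (fun z => A z i j) x) :
    AnalyticAt ℂ (fun z => (A z).det) x := by
  simp_rw [Matrix.det_apply']
  refine Finset.analyticAt_fun_sum _ fun σ _ => ?_
  refine analyticAt_const.mul ?_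
  exact Finset.analyticAt_fun_prod _ fun i _ => hA (σ i) i

/-- The entries of the adjugate of a matrix of meromorphic functions are meromorphic. [folklore] -/
theorem MeromorphicAt.matrix_adjugate {A : ℂ → Matrix n n ℂ} {x : ℂ} (hA : ∀ i j, MeromorphicAt (fun z => A z i j) x)
    (i j : n) : MeromorphicAt (fun z => (A z).adjugate i j) x := by
  simp_rw [Matrix.adjugate_apply]
  refine MeromorphicAt.matrix_det fun a b => ?_
  simp_rw [Matrix.updateRow_apply]
  by_cases hab : a = j
  · simp_rw [if_pos hab]; exact MeromorphicAt.const _ x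
  · simp_rw [if_neg hab]; exact hA a b

/-- **The entries of the inverse of a matrix of meromorphic functions are meromorphic** (the inverse
being `det⁻¹ • adjugate`, with the convention `0⁻¹ = 0`). [folklore] -/
theorem MeromorphicAt.matrix_inv {A : ℂ → Matrix n n ℂ} {x : ℂ} (hA : ∀ i j, MeromorphicAt (fun z => A z i j) x)
    (i j : n) : MeromorphicAt (fun z => (A z)⁻¹ i j) x := by
  have e : ∀ z, (A z)⁻¹ i j = ((A z).det)⁻¹ * (A z).adjugate i j := by
    intro z
    rw [Matrix.inv_def, Matrix.smul_apply, Ring.inverse_eq_inv, smul_eq_mul]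
  simp_rw [e]
  exact (MeromorphicAt.matrix_det hA).inv.mul (MeromorphicAt.matrix_adjugate hA i j)

/-- `z ↦ (A z)⁻¹ *ᵥ (c z)` has meromorphic components. [folklore] -/
theorem MeromorphicAt.matrix_inv_mulVec {A : ℂ → Matrix n n ℂ} {c : ℂ → n → ℂ} {x : ℂ}
    (hA : ∀ i j, MeromorphicAt (fun z => A z i j) x) (hc : ∀ i, MeromorphicAt (fun z => c z i) x) (i : n) :
    MeromorphicAt (fun z => ((A z)⁻¹ *ᵥ c z) i) x := by
  simp_rw [Matrix.mulVec, dotProduct]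
  exact MeromorphicAt.fun_sum fun j _ => (MeromorphicAt.matrix_inv hA i j).mul (hc j)

end MeroHelpers

/-! ## 1. Resolvent kernels -/

/-- **A resolvent kernel**: a non-negative Lipschitz test kernel `k` of positive mass supported in
`u ≤ M` with `R_M = 2 arsinh √M ≤ 1` — the data through which the continuation is run (for such `k`
the eigenvalue `ĥ_k(s)` of `T_k` on `𝒜_s` does not vanish on the strip `R_M |Im s| < π/2`).
[cite: Iwaniec2002, §1.8 & Thm 1.16, PDF pp. 20–24] -/
structure RKernel where
  /-- the kernel -/
  k : ℝ → ℝ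
  /-- the support bound: `k = 0` on `[M, ∞)` -/
  M : ℝ
  /-- a Lipschitz constant -/
  L : ℝ≥0
  /-- a bound for `|k|` -/
  Bk : ℝ
  test : IsTestKernel k
  lip : LipschitzWith L k
  bound : ∀ u, |k u| ≤ Bk
  supp : ∀ u, M ≤ u → k u = 0
  M_nonneg : 0 ≤ M
  nonneg : ∀ u, 0 ≤ k u
  mass_pos : 0 < ∫ u in Ioi 0, k u
  radius_le : 2 * Real.arsinh (Real.sqrt M) ≤ 1

namespace RKernel

/-- **The kernel of the strip of height `N + 1`** (`bumpKernel` of support `stripSupport N`).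
[folklore] -/
def ofStrip (N : ℕ) : RKernel where
  k := bumpKernel (stripSupport N) (stripSupport_pos N)
  M := stripSupport N
  L := (exists_lipschitzWith_bumpKernel (stripSupport_pos N)).choose
  Bk := 1
  test := isTestKernel_bumpKernel (stripSupport_pos N)
  lip := (exists_lipschitzWith_bumpKernel (stripSupport_pos N)).choose_spec
  bound := fun u => by
    rw [abs_of_nonneg (bumpKernel_nonneg _ u)]; exact bumpKernel_le_one _ u
  supp := fun _ hu => bumpKernel_eq_zero _ hu
  M_nonneg := (stripSupport_pos N).le
  nonneg := bumpKernel_nonneg _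
  mass_pos := integral_bumpKernel_pos _
  radius_le := by
    have h := kernelRadius_stripSupport_le N
    unfold kernelRadius at h
    refine h.trans ?_
    rw [div_le_one (by positivity)]
    linarith [(Nat.cast_nonneg N : (0 : ℝ) ≤ N)]

variable (κ : RKernel)

/-- The kernel is continuous. [folklore] -/
theorem continuous : Continuous κ.k := κ.lip.continuous

/-- **The strip of the kernel**: `{s : R_M |Im s| < π/2}`, where `Re ĥ_k(s) > 0`. [folklore] -/
def strip : Set ℂ := {s : ℂ | 2 * Real.arsinh (Real.sqrt κ.M) * |s.im| < π / 2}

/-- Membership. [folklore] -/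
theorem mem_strip_iff {s : ℂ} : s ∈ κ.strip ↔ 2 * Real.arsinh (Real.sqrt κ.M) * |s.im| < π / 2 := Iff.rfl

/-- The strip is open. [folklore] -/
theorem isOpen_strip : IsOpen κ.strip :=
  isOpen_lt (continuous_const.mul (continuous_abs.comp Complex.continuous_im)) continuous_const

/-- The strip is convex. [folklore] -/
theorem convex_strip : Convex ℝ κ.strip := by
  intro s hs t ht a b ha hb hab
  rw [mem_strip_iff] at hs ht ⊢
  have hc : 0 ≤ 2 * Real.arsinh (Real.sqrt κ.M) :=
    mul_nonneg zero_le_two (Real.arsinh_nonneg_iff.mpr (Real.sqrt_nonneg _))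
  have him : (a • s + b • t).im = a * s.im + b * t.im := by simp
  rw [him]
  have h1 : |a * s.im + b * t.im| ≤ a * |s.im| + b * |t.im| := by
    calc |a * s.im + b * t.im| ≤ |a * s.im| + |b * t.im| := abs_add_le _ _
      _ = a * |s.im| + b * |t.im| := by rw [abs_mul, abs_mul, abs_of_nonneg ha, abs_of_nonneg hb]
  calc 2 * Real.arsinh (Real.sqrt κ.M) * |a * s.im + b * t.im|
      ≤ 2 * Real.arsinh (Real.sqrt κ.M) * (a * |s.im| + b * |t.im|) := mul_le_mul_of_nonneg_left h1 hc
    _ = a * (2 * Real.arsinh (Real.sqrt κ.M) * |s.im|) + b * (2 * Real.arsinh (Real.sqrt κ.M) * |t.im|) := by ring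
    _ < a * (π / 2) + b * (π / 2) := by
        rcases ha.lt_or_eq with ha' | ha'
        · exact add_lt_add_of_lt_of_le (mul_lt_mul_of_pos_left hs ha') (mul_le_mul_of_nonneg_left ht.le hb)
        · rw [← ha'] at hab ⊢
          simp only [zero_mul, zero_add] at hab ⊢
          rw [hab]; simp only [one_mul]; exact ht
    _ = π / 2 := by rw [← add_mul, hab, one_mul]

/-- The strip is preconnected. [folklore] -/
theorem isPreconnected_strip : IsPreconnected κ.strip := by
  have hne : κ.strip.Nonempty := ⟨0, by rw [mem_strip_iff]; simp [Real.pi_pos]⟩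
  exact (κ.convex_strip.isPathConnected hne).isConnected.isPreconnected

/-- The strip contains the horizontal strip `|Im s| < π/2` (as `R_M ≤ 1`). [folklore] -/
theorem mem_strip_of_abs_im_lt {s : ℂ} (hs : |s.im| < π / 2) : s ∈ κ.strip := by
  rw [mem_strip_iff]
  have hc : 0 ≤ 2 * Real.arsinh (Real.sqrt κ.M) :=
    mul_nonneg zero_le_two (Real.arsinh_nonneg_iff.mpr (Real.sqrt_nonneg _))
  calc 2 * Real.arsinh (Real.sqrt κ.M) * |s.im| ≤ 1 * |s.im| :=
        mul_le_mul_of_nonneg_right κ.radius_le (abs_nonneg _)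
    _ = |s.im| := one_mul _
    _ < π / 2 := hs

/-- **`ĥ_k(s) ≠ 0` on the strip.** [folklore] -/
theorem eigenvalueFn_ne_zero {s : ℂ} (hs : s ∈ κ.strip) : eigenvalueFn κ.k s ≠ 0 :=
  Literature.NumberTheory.Automorphic.eigenvalueFn_ne_zero κ.test κ.nonneg κ.mass_pos κ.supp κ.M_nonneg hs

/-- `ĥ_k` is analytic. [folklore] -/
theorem analyticAt_eigenvalueFn (s : ℂ) : AnalyticAt ℂ (eigenvalueFn κ.k) s :=
  Literature.NumberTheory.Automorphic.analyticAt_eigenvalueFn κ.test s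

/-- **`Im ĥ_k(s) ≠ 0`** for `s` in the strip off the lines `Im s = 0`, `Re s = 1/2`. [folklore] -/
theorem im_eigenvalueFn_ne_zero {s : ℂ} (hs : s ∈ κ.strip) (him : s.im ≠ 0) (hre : s.re ≠ 1 / 2) :
    (eigenvalueFn κ.k s).im ≠ 0 := by
  refine eigenvalueFn_im_ne_zero κ.test κ.nonneg κ.mass_pos κ.supp κ.M_nonneg him hre ?_
  have := κ.mem_strip_iff.mp hs
  linarith [Real.pi_pos]

/-- The strip of the `N`-th kernel contains `|Im s| < N + 1`. [folklore] -/
theorem mem_strip_ofStrip {N : ℕ} {s : ℂ} (hs : |s.im| < (N : ℝ) + 1) : s ∈ (ofStrip N).strip :=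
  stripSupport_small hs

end RKernel

/-- **The base point `s₀ = 2 + i/2`** at which the linear system for the scattering row is anchored:
`Re s₀ > 1` (so the Eisenstein series is given by its series) and `Im ĥ_k(s₀) ≠ 0` (so no `L²`
eigenfunction of the self-adjoint `T_k` has the eigenvalue `ĥ_k(s₀)`). [folklore] -/
def baseParam : ℂ := 2 + Complex.I / 2

/-- `Re s₀ = 2`. [folklore] -/
theorem baseParam_re : baseParam.re = 2 := by simp [baseParam]

/-- `Im s₀ = 1/2`. [folklore] -/
theorem baseParam_im : baseParam.im = 1 / 2 := by simp [baseParam]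

/-- `s₀` lies in every strip. [folklore] -/
theorem baseParam_mem_strip (κ : RKernel) : baseParam ∈ κ.strip := by
  apply κ.mem_strip_of_abs_im_lt
  rw [baseParam_im, abs_of_pos (by norm_num : (0 : ℝ) < 1 / 2)]
  linarith [Real.pi_gt_three]

/-- `Im ĥ_k(s₀) ≠ 0`. [folklore] -/
theorem im_eigenvalueFn_baseParam_ne_zero (κ : RKernel) : (eigenvalueFn κ.k baseParam).im ≠ 0 :=
  κ.im_eigenvalueFn_ne_zero (baseParam_mem_strip κ) (by rw [baseParam_im]; norm_num) (by rw [baseParam_re]; norm_num)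

/-- `1 < Re s₀`. [folklore] -/
theorem one_lt_baseParam_re : 1 < baseParam.re := by rw [baseParam_re]; norm_num

/-! ## 2. Identity principles for functions meromorphic in normal form -/

section NFHelpers

variable {V : Type*} [NormedAddCommGroup V] [NormedSpace ℂ V]

/-- Normal form on a set restricts to subsets. [folklore] -/
theorem _root_.MeromorphicNFOn.mono' {f : ℂ → V} {U W : Set ℂ} (hf : MeromorphicNFOn f U) (h : W ⊆ U) :
    MeromorphicNFOn f W := fun _ hz => hf (h hz)

/-- **Identity theorem for functions in normal form**: two functions meromorphic in normal form on a
preconnected set which agree on a punctured neighbourhood of one of its points agree on the whole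
set. [folklore] -/
theorem _root_.MeromorphicNFOn.eqOn_of_eventuallyEq {f g : ℂ → V} {U : Set ℂ} (hf : MeromorphicNFOn f U)
    (hg : MeromorphicNFOn g U) (hU : IsPreconnected U) {z₀ : ℂ} (hz₀ : z₀ ∈ U) (h : ∀ᶠ z in 𝓝[≠] z₀, f z = g z) :
    EqOn f g U := fun _ hz =>
  (((hf hz).eventuallyEq_nhdsNE_iff_eventuallyEq_nhds (hg hz)).mp
    (hf.meromorphicOn.eventually_eq_of_eventually_eq hg.meromorphicOn hU hz₀ h hz)).eq_of_nhds

/-- **A function in normal form which agrees near one point with an analytic function agrees with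
it — and is analytic — on any preconnected part of the domain of analyticity.** [folklore] -/
theorem _root_.MeromorphicNFOn.eqOn_and_analyticOnNhd {f g : ℂ → V} {U W : Set ℂ} (hf : MeromorphicNFOn f U)
    (hWU : W ⊆ U) (hg : AnalyticOnNhd ℂ g W) (hW : IsPreconnected W) {z₀ : ℂ} (hz₀ : z₀ ∈ W)
    (h : f =ᶠ[𝓝 z₀] g) : EqOn f g W ∧ AnalyticOnNhd ℂ f W := by
  have key : ∀ z ∈ W, f =ᶠ[𝓝 z] g := fun z hz =>
    ((hf (hWU hz)).eventuallyEq_nhdsNE_iff_eventuallyEq_nhds (hg z hz).meromorphicNFAt).mp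
      ((hf.mono' hWU).meromorphicOn.eventually_eq_of_eventually_eq hg.meromorphicOn hW hz₀ h.nhdsNE_of_nhds hz)
  exact ⟨fun z hz => (key z hz).eq_of_nhds, fun z hz => (analyticAt_congr (key z hz)).mpr (hg z hz)⟩

/-- The normal form of a meromorphic function agrees, near a point of analyticity, with any analytic
function the original agrees with there. [folklore] -/
theorem toMeromorphicNFOn_eventuallyEq_of_eventuallyEq {f g : ℂ → V} {U : Set ℂ} (hf : MeromorphicOn f U)
    {z₀ : ℂ} (hz₀ : z₀ ∈ U) (hg : AnalyticAt ℂ g z₀) (h : f =ᶠ[𝓝 z₀] g) :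
    toMeromorphicNFOn f U =ᶠ[𝓝 z₀] g := by
  have h1 : toMeromorphicNFOn f U =ᶠ[𝓝[≠] z₀] g :=
    (hf.toMeromorphicNFOn_eq_self_on_nhdsNE hz₀).trans (h.filter_mono nhdsWithin_le_nhds)
  exact ((meromorphicNFOn_toMeromorphicNFOn f U hz₀).eventuallyEq_nhdsNE_iff_eventuallyEq_nhds hg.meromorphicNFAt).mp h1

end NFHelpers

end Literature.NumberTheory.Automorphic
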